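import Summits.QuantumFields.BalabanUV.T4Continuum.Support.SubstrateTransporterSpeciesLevExplicit
import Mathlib.Analysis.Normed.Lp.lpSpace

/-!
# SUBSTRATE — [dict] D-8: THE COMPLEX CHART `𝒰ℂ` WITH ITS REAL SECTION (typer NEXT gen 7.1 W-3, LIBRARY L-E7; NE5 owner g35 RULING R49 (5)(ii)
# l.16073 «the complex chart χ with a REAL SECTION ι over admB», typing (T1)): `𝒰ℂ := TowerData P o` (complex transporter towers), the two-sided
# reading `chi R := (R, R⁻¹)`, the real section `towerDataOf P ι av` (unitary data: `chi` = the real slice `(R, adjOf ∘ R)` there, and the species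
# READ THE RECORD), the species ANALYTIC ON `𝒰ℂ` ITSELF off the singular set (affine road) and near every section point, the explicit exponential
# sub-chart (`SubstrateTransporterSpeciesLevExplicit`) as a `chi`-compatible chart of `𝒰ℂ`, ONE ℓ^∞ lemma, and the TWO-RUN section on the carriers

Cell `pub-balaban`, SUBSTRATE cell, seat `b2b-balaban-substrate-p1` (gen 3).  Summits-side under the LEAN PLACEMENT RULE.  HONEST FRAMING: rung (B)+1
of the FINITE-VOLUME T⁴ programme — NOT infinite volume, NOT a mass gap, NOT Clay; spine PROVED 0∕9; NE5 ∕ NE9 NOT proved.  TYPING + CALCULUS GLUE BY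
NAME (p220490 `adjOf_eq_inv` ∕ `expChartInv_mul_expChart`, p221513 §1–§2 `analyticAt_matrix_inv` ∕ `analyticAt_unitCovT`, p223342 ∕ p223952 balls):
0 analysis.  HONEST PRECISION (typer LIBRARY v0.1.1): on NE5's Road D the complex TERM families `ℰA ∕ ℰB : (ℕ → ℝ) → 𝒰ℂ → C.Dom → ℂ` read at chart
points are [Balaban1987RG1] Thm 1 (1.17)–(1.18) — DISPLAYED inputs asserted by nobody; the substrate supplies the chart, the section, and the OPERATOR
species at chart points (this file + `…Lev` ∕ `…LevExplicit`), never `ℰ`.  [Balaban1985BackgroundPropagators] Sect. B (Gᶜ-valued transporters) is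
the KIND-level warrant only.  HONEST DEPENDENCY (cell line, verbatim): continuum YM on T⁴ ⇐ BetaPertH ∧ nine spine estimates (0/9 proved);
BetaPertH ⇐ (D1) ∧ (D4) ∧ CAP+tail; G-an2-4 gates asym, D1 and NE2/3/4.

WHAT.
* §1 `𝒰ℂ` IS `TowerData P o` (no alias); `invT R := (k ν b ↦ (R k ν b)⁻¹)`, **`chi R := (R, invT R)`** (the `ComplexBackgroundFamily.ofInvertible`
  road); at unitary data `invT = adjOf ∘ ·` (`invT_eq_adjOf_of_unitary`), so at the REAL SECTION `towerDataOf P ι av U` (unitary `ι`) `chi` is the real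
  slice and **`covAtTLev_chi_towerDataOf`**: the level-lettered species at `chi (towerDataOf U)` IS the covariance OF RECORD at `U` («the section
  reads the record»); the exponential chart is `chi`-compatible: **`chi_expChartT`** (`chi (expChartT P R⁰ A) = (expChartT P R⁰ A, expChartInvT P R⁰ A)`
  at invertible `R⁰`), `chi_eq_expChart_zero`.
* §2 AFFINE ANALYTICITY ON `𝒰ℂ`: `affRegularAt ∕ affRegularLev` (coordinates invertible ∧ `deltaQT … (R k) (invT R k)` invertible, level letters),
  `analyticAt_apply ∕ analyticAt_invT_apply`, **`analyticOnNhd_covAtTLev_chi`** (every entry of `R ↦ covAtTLev … R (invT R)` analytic on `affRegularLev`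
  — p221513 §2 BY NAME with `S := invT` via `analyticAt_matrix_inv`), `isOpen_affRegularLev`, **`towerDataOf_mem_affRegularLev_of_regular`**
  (printed letters, J-3a BY NAME), **`exists_ball_analyticOnNhd_covAtTLev_chi_towerDataOf`** (local analyticity AT EVERY SECTION POINT in `𝒰ℂ` itself;
  openness radius) — the EXPLICIT radius lives on the exponential sub-chart: `SubstrateTransporterSpeciesLevExplicit.analyticOnNhd_covAtTLev_printed_towerDataOf_explicit`.
* §3 the DISPLAYED small-field domain `expBallDomain adm ρ := ⋃_{U ∈ adm} expChartT P (towerDataOf U) '' ball 0 ρ` ⊆ `𝒰ℂ` and ONE ℓ^∞ lemma (R49 (3)'s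
  currency `lp (fun _ => E) ∞` is CONSUMER-side): **`memℓp_greenT_expChartT`** ∕ `norm_greenTFam_le` — the chart Green's functions over the explicit
  ball form an ℓ^∞ family of norm `≤ 4∕γ` (`opNorm_greenT_le_on_ballExplicit` + `memℓp_infty`).
* §4 THE TWO-RUN SECTION on the carriers OF RECORD `D : DrivenRuns G`: `TwoRunChart D o := TowerData (D.F.P D.K) o × TowerData (D.F.P (D.K+1)) o`,
  **`sectionOfRecord D ι U := (towerDataOf _ ι D.avA (D.carriers.transport U).1, towerDataOf _ ι D.avB U.1)`** (run A through the transporter exactly as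
  `rawAOfRecord`, run B at `U`) — the `ι : C.BgB → 𝒰` of NE5's `ne5_of_ne5_reImTab` ∕ leaf-02's `ne5_of_section` at `𝒰 := TwoRunChart D o`; rfl views.
-/

noncomputable section

open scoped BigOperators ComplexConjugate Matrix Matrix.Norms.L2Operator Kronecker ComplexOrder

namespace Summit.QuantumFields.BalabanUV.T4Continuum.SubstrateChartSection

open Literature.MathematicalPhysics.QuantumFieldTheory.Balaban1983to89
open Literature.MathematicalPhysics.QuantumFieldTheory.Balaban1983to89.B5Prop11Plancherel (Tor fine)
open Literature.MathematicalPhysics.QuantumFieldTheory.Balaban1983to89.B5G183RateUnitTower (lev lev_neZero)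
open Summit.QuantumFields.BalabanUV.T4Continuum
open Summit.QuantumFields.BalabanUV.T4Continuum.CoerciveInverseTower (Coercive)
open Summit.QuantumFields.BalabanUV.T4Continuum.CovariantVectorCoercive (vecOp gammaV)
open Summit.QuantumFields.BalabanUV.T4Continuum.CovariantVectorGreenOfField (isUnit_det_deltaQOf_of_regular)
open Summit.QuantumFields.BalabanUV.T4Continuum.SubstrateCovariantAveraging (deltaQOf)
open Summit.QuantumFields.BalabanUV.T4Continuum.SubstrateBackgroundTransporters (transV siteIdx unitMod transV_mem_unitaryGroup)
open Summit.QuantumFields.BalabanUV.T4Continuum.SubstrateTransporterSpecies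
open Summit.QuantumFields.BalabanUV.T4Continuum.SubstrateTransporterSpeciesHolo (expChartT expChartInvT expChartT_apply expChartInvT_apply
  expChartT_zero expChartInvT_zero regularSetAt)
open Summit.QuantumFields.BalabanUV.T4Continuum.SubstrateTransporterSpeciesAnalytic (analyticAt_matrix_iff analyticAt_matrix_inv analyticAt_coord
  analyticAt_level analyticAt_deltaQT analyticAt_unitCovT)
open Summit.QuantumFields.BalabanUV.T4Continuum.SubstrateTransporterSpeciesLev (regularSetLev cPr aPr covAtTLev covAtOfRecord_eq_covAtTLev)
open Summit.QuantumFields.BalabanUV.T4Continuum.SubstrateTransporterSpeciesLevExplicit (rhoLev rhoLev_pos opNorm_greenT_le_on_ballExplicit)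
open Summit.QuantumFields.BalabanUV.T4Continuum.SubstrateTwoRunsDriven (DrivenRuns)
open Summit.QuantumFields.BalabanUV.T4Continuum.CovariantBlockAveraging (ContourSystem transport)

variable (P : Params) {o : Type*} [Fintype o] [DecidableEq o]

/-! ## §1 The chart `𝒰ℂ := TowerData P o`, the two-sided reading `chi`, the real section `towerDataOf` -/

/-- [folklore] The pointwise inverse of a transporter tower — the `S`-side («U⁻¹») of the two-sided reading of a chart point. -/
def invT (R : TowerData P o) : TowerData P o := fun k ν b => (R k ν b)⁻¹

/-- [folklore] **THE TWO-SIDED READING OF A CHART POINT** `chi R := (R, R⁻¹)`: the complex chart `𝒰ℂ := TowerData P o` of [dict] D-8 maps into the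
pair data the species `covAtT ∕ covAtTLev` read (the `ComplexBackgroundFamily.ofInvertible` road; nothing is inverted inside the species). -/
def chi (R : TowerData P o) : TowerData P o × TowerData P o := (R, invT P R)

/-- [folklore] `rfl` views of `chi`. -/
theorem chi_fst (R : TowerData P o) : (chi P R).1 = R := rfl

/-- [folklore] `rfl` view of the second member. -/
theorem chi_snd (R : TowerData P o) : (chi P R).2 = invT P R := rfl

/-- [folklore] At UNITARY tower data the pointwise inverse is the pointwise adjoint: `chi` reads the REAL SLICE `(R, adjOf ∘ R)` (p220490 `adjOf_eq_inv`). -/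
theorem invT_eq_adjOf_of_unitary {R : TowerData P o} (hR : ∀ (k : Fin (P.K + 1)) ν i, R k ν i ∈ Matrix.unitaryGroup o ℂ) :
    invT P R = fun k => adjOf (R k) :=
  funext fun k => (adjOf_eq_inv (hR k)).symm

variable {G : Type*} [GaugeGroup G] (ι : G →* Matrix o o ℂ) (av : ∀ j, Averaging P j G)

/-- [folklore] **THE REAL SECTION IS `towerDataOf P ι av`** (EXISTS, p220490): for unitary-valued `ι` its two-sided reading is the real slice. -/
theorem invT_towerDataOf (hι : ∀ g, ι g ∈ Matrix.unitaryGroup o ℂ) (U : GaugeField P 0 G) :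
    invT P (towerDataOf P ι av U) = fun k => adjOf (towerDataOf P ι av U k) :=
  invT_eq_adjOf_of_unitary P fun k ν i => transV_mem_unitaryGroup _ hι (Averaging.iter av (P.K - k) U) ν i

variable (cL : ℕ → ℂ) (aL : ℕ → ℝ) (s : ℕ → ℂ) (Γ : (k : ℕ) → ContourSystem P.d (lev P.L k) (unitMod P))

/-- [folklore] **THE SECTION READS THE RECORD**: at the section point `towerDataOf P ι av U` (unitary `ι`) the level-lettered species read through
`chi` IS the covariance family OF RECORD at `U` (p223342 `covAtOfRecord_eq_covAtTLev` + `invT_towerDataOf`). -/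
theorem covAtTLev_chi_towerDataOf (hι : ∀ g, ι g ∈ Matrix.unitaryGroup o ℂ) (U : GaugeField P 0 G) (k : ℕ) {T : Type*} (t : T)
    (b b' : (Tor (unitMod P) × Fin P.d) × o) :
    covAtTLev P cL aL Γ s (chi P (towerDataOf P ι av U)).1 (chi P (towerDataOf P ι av U)).2 k t b b' =
      SubstrateRawSpecies.covAtOfRecord P ι av (cL k) (aL k) s Γ U k t b b' := by
  rw [chi_fst, chi_snd, invT_towerDataOf P ι av hι, covAtOfRecord_eq_covAtTLev]

/-- [folklore] `chi R⁰` is the CENTRE of the exponential chart at `R⁰`: `(expChartT P R⁰ 0, expChartInvT P R⁰ 0)`. -/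
theorem chi_eq_expChart_zero (R₀ : TowerData P o) : chi P R₀ = (expChartT P R₀ 0, expChartInvT P R₀ 0) := by
  rw [expChartT_zero, expChartInvT_zero]; rfl

/-- [folklore] **THE EXPONENTIAL CHART IS `chi`-COMPATIBLE**: at a reference tower with invertible entries, `chi (expChartT P R⁰ A) =
(expChartT P R⁰ A, expChartInvT P R⁰ A)` — so every theorem along `(expChartT, expChartInvT)` (`…Lev`, `…LevExplicit`) is a theorem about the
species on `𝒰ℂ` read through `chi`, on the image of the exponential sub-chart (p220490 `expChartInv_mul_expChart`). -/
theorem chi_expChartT {R₀ : TowerData P o} (hR₀ : ∀ (k : Fin (P.K + 1)) ν i, IsUnit (R₀ k ν i).det) (A : TowerData P o) :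
    chi P (expChartT P R₀ A) = (expChartT P R₀ A, expChartInvT P R₀ A) := by
  refine Prod.ext rfl (funext fun k => funext fun ν => funext fun i => ?_)
  change (expChartT P R₀ A k ν i)⁻¹ = expChartInvT P R₀ A k ν i
  rw [expChartT_apply, expChartInvT_apply]
  exact Matrix.inv_eq_left_inv (expChartInv_mul_expChart (hR₀ k) (A k) ν i)

/-- [folklore] … in particular at unitary reference towers (every section point). -/
theorem chi_expChartT_of_unitary {R₀ : TowerData P o} (hR₀ : ∀ (k : Fin (P.K + 1)) ν i, R₀ k ν i ∈ Matrix.unitaryGroup o ℂ) (A : TowerData P o) :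
    chi P (expChartT P R₀ A) = (expChartT P R₀ A, expChartInvT P R₀ A) :=
  chi_expChartT P (fun k ν i => isUnit_det_of_mem_unitaryGroup (hR₀ k ν i)) A

/-! ## §2 The species are analytic on `𝒰ℂ` itself off the singular set (affine road), and near every section point -/

/-- [folklore] The level-`k` AFFINE REGULAR SET of `𝒰ℂ`: towers whose level-`k` transporters are invertible and whose level-`k` two-sided operator
`deltaQT … (R k) (R k)⁻¹` (letters `(cL k, aL k)`) is invertible. -/
def affRegularAt (k : Fin (P.K + 1)) : Set (TowerData P o) :=
  {R | (∀ ν b, IsUnit (R k ν b).det) ∧ IsUnit (deltaQT (lev P.L k) (unitMod P) (cL k) (aL k) (Γ k) (R k) (invT P R k)).det}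

/-- [folklore] The affine regular set: regular at every level `k ≤ K`. -/
def affRegularLev : Set (TowerData P o) := ⋂ k : Fin (P.K + 1), affRegularAt P cL aL Γ k

/-- [folklore] Each transporter coordinate `R ↦ R k ν b` is analytic on `𝒰ℂ` (continuous linear). -/
theorem analyticAt_apply (k : Fin (P.K + 1)) (ν : Fin P.d) (b : Tor (fine (lev P.L k) (unitMod P)) × Fin P.d) (R₀ : TowerData P o) :
    AnalyticAt ℂ (fun R : TowerData P o => R k ν b) R₀ :=
  have h := (analyticAt_coord ν b (R₀ k)).comp (f := fun R : TowerData P o => R k) (analyticAt_level P k R₀)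
  h

/-- [folklore] … and `R ↦ (R k ν b)⁻¹` is analytic where that coordinate is invertible (`analyticAt_matrix_inv`, p221513 §1). -/
theorem analyticAt_invT_apply {R₀ : TowerData P o} (k : Fin (P.K + 1)) (ν : Fin P.d) (b : Tor (fine (lev P.L k) (unitMod P)) × Fin P.d)
    (h : IsUnit (R₀ k ν b).det) : AnalyticAt ℂ (fun R : TowerData P o => invT P R k ν b) R₀ :=
  analyticAt_matrix_inv (analyticAt_apply P k ν b R₀) h

/-- [folklore] The level-`k` two-sided covariance read through `chi` is analytic at every affine-regular point (p221513 `analyticAt_unitCovT` with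
`S := invT`). -/
theorem analyticAt_unitCovT_chi {R₀ : TowerData P o} (k : Fin (P.K + 1)) (hR₀ : R₀ ∈ affRegularAt P cL aL Γ k) (sc : ℂ) :
    AnalyticAt ℂ (fun R : TowerData P o => unitCovT (lev P.L k) (unitMod P) (cL k) (aL k) sc (Γ k) (R k) (invT P R k)) R₀ :=
  analyticAt_unitCovT (lev P.L k) (unitMod P) (fun ν i => analyticAt_apply P k ν i R₀) (fun ν i => analyticAt_invT_apply P k ν i (hR₀.1 ν i))
    hR₀.2 sc

/-- [folklore] **THE SPECIES ARE ANALYTIC FUNCTIONS ON `𝒰ℂ`**: every entry of `R ↦ covAtTLev … R (invT R)` (the species read through `chi`) is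
analytic on the affine regular set — every level (levels `> K` read `0`), slot and index pair. -/
theorem analyticOnNhd_covAtTLev_chi (k : ℕ) {T : Type*} (t : T) (b b' : (Tor (unitMod P) × Fin P.d) × o) :
    AnalyticOnNhd ℂ (fun R : TowerData P o => covAtTLev P cL aL Γ s R (invT P R) k t b b') (affRegularLev P cL aL Γ) := by
  unfold covAtTLev covAtT
  by_cases hk : k ≤ P.K
  · simp only [dif_pos hk]
    intro R₀ hR₀
    exact analyticAt_matrix_iff.1 (analyticAt_unitCovT_chi P cL aL Γ ⟨k, Nat.lt_succ_of_le hk⟩ (Set.mem_iInter.1 hR₀ _) (s k)) b b'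
  · simp only [dif_neg hk]
    exact fun _ _ => analyticAt_const

omit [Fintype o] [DecidableEq o] in
/-- [folklore] `det ∘ g` is continuous at a point where the matrix map `g` is. -/
theorem continuousAt_det_comp {X : Type*} [TopologicalSpace X] {n : Type*} [Fintype n] [DecidableEq n] {g : X → Matrix n n ℂ} {x : X}
    (hg : ContinuousAt g x) : ContinuousAt (fun y => (g y).det) x :=
  have hd : Continuous fun A : Matrix n n ℂ => A.det := continuous_id.matrix_det
  hd.continuousAt.comp hg

/-- [folklore] The level-`k` affine regular set is OPEN (at a point of the set the finitely many coordinate determinants and the determinant of the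
two-sided operator are continuous and nonzero, hence nonzero nearby). -/
theorem isOpen_affRegularAt (k : Fin (P.K + 1)) : IsOpen (affRegularAt P (o := o) cL aL Γ k) := by
  rw [isOpen_iff_mem_nhds]
  intro R₀ hR₀
  have h1 : ∀ᶠ R in nhds R₀, ∀ ν b, IsUnit (R k ν b).det := by
    simp only [Filter.eventually_all]
    intro ν b
    have hc : ContinuousAt (fun R : TowerData P o => (R k ν b).det) R₀ := continuousAt_det_comp (analyticAt_apply P k ν b R₀).continuousAt
    simpa only [isUnit_iff_ne_zero] using hc.eventually_ne (isUnit_iff_ne_zero.1 (hR₀.1 ν b))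
  have h2 : ∀ᶠ R in nhds R₀, IsUnit (deltaQT (lev P.L k) (unitMod P) (cL k) (aL k) (Γ k) (R k) (invT P R k)).det := by
    have hc : ContinuousAt (fun R : TowerData P o => (deltaQT (lev P.L k) (unitMod P) (cL k) (aL k) (Γ k) (R k) (invT P R k)).det) R₀ :=
      continuousAt_det_comp (analyticAt_deltaQT (lev P.L k) (unitMod P) (fun ν i => analyticAt_apply P k ν i R₀)
        (fun ν i => analyticAt_invT_apply P k ν i (hR₀.1 ν i)) (cL k) (aL k) (Γ k)).continuousAt
    simpa only [isUnit_iff_ne_zero] using hc.eventually_ne (isUnit_iff_ne_zero.1 hR₀.2)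
  exact (h1.and h2).mono fun R hR => hR

/-- [folklore] **THE AFFINE REGULAR SET IS OPEN.** -/
theorem isOpen_affRegularLev : IsOpen (affRegularLev P (o := o) cL aL Γ) :=
  isOpen_iInter_of_finite fun k => isOpen_affRegularAt P cL aL Γ k

/-- [folklore] A UNITARY tower is level-`k` affine-regular iff its real-slice operator `deltaQT … (R k) (adjOf (R k))` is invertible. -/
theorem mem_affRegularAt_of_unitary {R : TowerData P o} (hR : ∀ (k : Fin (P.K + 1)) ν i, R k ν i ∈ Matrix.unitaryGroup o ℂ) (k : Fin (P.K + 1))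
    (h : IsUnit (deltaQT (lev P.L k) (unitMod P) (cL k) (aL k) (Γ k) (R k) (adjOf (R k))).det) : R ∈ affRegularAt P cL aL Γ k := by
  refine ⟨fun ν b => isUnit_det_of_mem_unitaryGroup (hR k ν b), ?_⟩
  rw [invT_eq_adjOf_of_unitary P hR]
  exact h

variable {a' α τ : ℝ}

/-- [folklore] **EVERY SECTION POINT OF A LEVELWISE-REGULAR CONFIGURATION IS AFFINE-REGULAR AT THE PRINTED LETTERS** (unitary `ι` with
`‖ι g − 1‖ = dist1 g`, small-field letters `α`, `τ` at every level, `0 < a′`, `0 < gammaV`) — J-3a `isUnit_det_deltaQOf_of_regular` BY NAME. -/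
theorem towerDataOf_mem_affRegularLev_of_regular (hι : ∀ g, ι g ∈ Matrix.unitaryGroup o ℂ) (hdist : ∀ g : G, ‖ι g - 1‖ = dist1 g)
    (U : GaugeField P 0 G) (ha' : 0 < a') (hα : 0 ≤ α) (hτ : 0 ≤ τ)
    (hU : ∀ (k : Fin (P.K + 1)) (b : PBond P (P.K - k)), ((lev P.L k : ℕ) : ℝ) * dist1 (Averaging.iter av (P.K - k) U b) ≤ α)
    (hT : ∀ (k : Fin (P.K + 1)) y jj μ (t : Fin (lev P.L k)),
      ‖transport (fine (lev P.L k) (unitMod P)) (towerDataOf P ι av U k) μ (Γ k y jj μ t) - 1‖ ≤ τ)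
    (hγV : 0 < gammaV (Fintype.card o) P.d a' α τ) :
    towerDataOf P ι av U ∈ affRegularLev P (cPr P) (aPr P a') Γ :=
  Set.mem_iInter.2 fun k =>
    mem_affRegularAt_of_unitary P (cPr P) (aPr P a') Γ (fun k ν i => transV_mem_unitaryGroup _ hι (Averaging.iter av (P.K - k) U) ν i) k <| by
      have h := isUnit_det_deltaQOf_of_regular P ι (Nat.sub_add_cancel (Nat.le_of_lt_succ k.2)) (Γ := Γ k) hdist ha' hα hτ (hU k) (hT k) hγV
      rw [deltaQOf_eq_deltaQT] at h
      exact h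

/-- [folklore] **LOCAL ANALYTICITY AT EVERY SECTION POINT, IN `𝒰ℂ` ITSELF**: around `towerDataOf P ι av U` (regular `U`, letters as above) there
is a ball of `𝒰ℂ` on which every entry of the species read through `chi` is analytic (openness radius; the EXPLICIT radius lives on the
exponential sub-chart — `SubstrateTransporterSpeciesLevExplicit.analyticOnNhd_covAtTLev_printed_towerDataOf_explicit`, `chi_expChartT`). -/
theorem exists_ball_analyticOnNhd_covAtTLev_chi_towerDataOf (hι : ∀ g, ι g ∈ Matrix.unitaryGroup o ℂ)
    (hdist : ∀ g : G, ‖ι g - 1‖ = dist1 g) (U : GaugeField P 0 G) (ha' : 0 < a') (hα : 0 ≤ α) (hτ : 0 ≤ τ)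
    (hU : ∀ (k : Fin (P.K + 1)) (b : PBond P (P.K - k)), ((lev P.L k : ℕ) : ℝ) * dist1 (Averaging.iter av (P.K - k) U b) ≤ α)
    (hT : ∀ (k : Fin (P.K + 1)) y jj μ (t : Fin (lev P.L k)),
      ‖transport (fine (lev P.L k) (unitMod P)) (towerDataOf P ι av U k) μ (Γ k y jj μ t) - 1‖ ≤ τ)
    (hγV : 0 < gammaV (Fintype.card o) P.d a' α τ) :
    ∃ ρ > 0, ∀ (k : ℕ) {T : Type*} (t : T) (b b' : (Tor (unitMod P) × Fin P.d) × o),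
      AnalyticOnNhd ℂ (fun R : TowerData P o => covAtTLev P (cPr P) (aPr P a') Γ s R (invT P R) k t b b')
        (Metric.ball (towerDataOf P ι av U) ρ) := by
  obtain ⟨ρ, hρ, hsub⟩ := Metric.isOpen_iff.1 (isOpen_affRegularLev P (cPr P) (aPr P a') Γ) _
    (towerDataOf_mem_affRegularLev_of_regular P ι av Γ hι hdist U ha' hα hτ hU hT hγV)
  exact ⟨ρ, hρ, fun k _ t b b' => (analyticOnNhd_covAtTLev_chi P (cPr P) (aPr P a') s Γ k t b b').mono hsub⟩

/-! ## §3 The displayed small-field domain and ONE ℓ^∞ lemma -/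

/-- [folklore] THE DISPLAYED SMALL-FIELD DOMAIN of `𝒰ℂ` (a side condition, asserted by nobody): the union over the admissible real backgrounds of the
exponential sub-charts of radius `ρ` — `⋃_{U ∈ adm} expChartT P (towerDataOf U) '' ball 0 ρ`. -/
def expBallDomain (adm : Set (GaugeField P 0 G)) (ρ : ℝ) : Set (TowerData P o) :=
  ⋃ U ∈ adm, expChartT P (towerDataOf P ι av U) '' Metric.ball (0 : TowerData P o) ρ

/-- [folklore] Every section point of an admissible background lies in the displayed domain (`ρ > 0`; the centre `A = 0`). -/
theorem towerDataOf_mem_expBallDomain {adm : Set (GaugeField P 0 G)} {ρ : ℝ} (hρ : 0 < ρ) {U : GaugeField P 0 G} (hU : U ∈ adm) :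
    towerDataOf P ι av U ∈ expBallDomain P ι av adm ρ :=
  Set.mem_biUnion hU ⟨0, Metric.mem_ball_self hρ, expChartT_zero P _⟩

section Linfty

variable [Nonempty o] {R₀ : TowerData P o} (hR₀ : ∀ (k : Fin (P.K + 1)) ν i, R₀ k ν i ∈ Matrix.unitaryGroup o ℂ) {γ : ℝ} (ha' : 0 ≤ a')
  (hco : ∀ k : Fin (P.K + 1), Coercive γ (vecOp (lev P.L k) (unitMod P) a' (Γ k) (R₀ k))) (hγ : 0 < γ)
  {ℓ : Fin (P.K + 1) → ℕ} (hΓ : ∀ (k : Fin (P.K + 1)) y j μ (t : Fin (lev P.L k)), (Γ k y j μ t).length ≤ ℓ k)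
  (hℓ : ∀ k : Fin (P.K + 1), (ℓ k : ℝ) ≤ ((P.d : ℝ) + 1) * (lev P.L k : ℕ))

include hR₀ ha' hco hγ hΓ hℓ in
/-- [folklore] **THE ℓ^∞ LEMMA** (R49 (3)'s currency `lp (fun _ => E) ∞` over the chart is CONSUMER-side; this is the substrate's contribution): over
the explicit ball `ball 0 rhoLev` of the exponential sub-chart at a unitary, levelwise `γ`-coercive tower, the level-`k` chart Green's functions form a
BOUNDED family — `Memℓp … ∞` by `memℓp_infty` from `opNorm_greenT_le_on_ballExplicit` (`≤ 4∕γ`). -/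
theorem memℓp_greenT_expChartT (k : Fin (P.K + 1)) :
    Memℓp (fun A : Metric.ball (0 : TowerData P o) (rhoLev P (o := o) γ a') =>
      greenT (lev P.L k) (unitMod P) (cPr P k) (aPr P a' k) (Γ k) (expChartT P R₀ A.1 k) (expChartInvT P R₀ A.1 k)) ⊤ :=
  memℓp_infty ⟨4 / γ, by
    rintro _ ⟨A, rfl⟩
    exact opNorm_greenT_le_on_ballExplicit P Γ hR₀ ha' hco hγ hΓ hℓ A.2 k⟩

/-- [folklore] … and the ℓ^∞ norm of that family is `≤ 4∕γ` (`lp.norm_le_of_forall_le`). -/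
theorem norm_greenTFam_le (k : Fin (P.K + 1)) :
    ‖(⟨_, memℓp_greenT_expChartT P Γ hR₀ ha' hco hγ hΓ hℓ k⟩ :
        lp (fun _ : Metric.ball (0 : TowerData P o) (rhoLev P (o := o) γ a') =>
          Matrix ((Tor (fine (lev P.L k) (unitMod P)) × Fin P.d) × o) ((Tor (fine (lev P.L k) (unitMod P)) × Fin P.d) × o) ℂ) ⊤)‖ ≤ 4 / γ :=
  lp.norm_le_of_forall_le (by positivity) fun A => opNorm_greenT_le_on_ballExplicit P Γ hR₀ ha' hco hγ hΓ hℓ A.2 k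

end Linfty

/-! ## §4 The two-run section on the carriers of record -/

section TwoRun

variable {G : Type} [GaugeGroup G] (D : DrivenRuns G) {o : Type} [Fintype o] [DecidableEq o] (ι : G →* Matrix o o ℂ)

/-- [folklore] **THE TWO-RUN CHART**: run A's and run B's complex transporter towers side by side (the runs live on different tori,
`D.F.P D.K` and `D.F.P (D.K + 1)`) — the `𝒰` of NE5's Road D over the carriers of record, each run's displayed term family reading its own factor. -/
abbrev TwoRunChart (D : DrivenRuns G) (o : Type) [Fintype o] [DecidableEq o] : Type :=
  TowerData (D.F.P D.K) o × TowerData (D.F.P (D.K + 1)) o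

/-- [folklore] **THE REAL SECTION OF RECORD** `ι : C.BgB → 𝒰` (the binder of `OutputRateFunctionalTablesComplex.ne5_of_ne5_reImTab` ∕
`OutputRateFunctionalTables.ne5_of_section` at `𝒰 := TwoRunChart D o`): run A read THROUGH THE TRANSPORTER exactly as `rawAOfRecord`
(`towerDataOf` of `D.carriers.transport U` with run A's averagings), run B at `U` itself. -/
def sectionOfRecord (U : D.carriers.BgB) : TwoRunChart D o :=
  (towerDataOf (D.F.P D.K) ι D.avA (D.carriers.transport U).1, towerDataOf (D.F.P (D.K + 1)) ι D.avB U.1)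

/-- [folklore] `rfl` view, run A. -/
theorem sectionOfRecord_fst (U : D.carriers.BgB) :
    (sectionOfRecord D ι U).1 = towerDataOf (D.F.P D.K) ι D.avA (D.carriers.transport U).1 := rfl

/-- [folklore] `rfl` view, run B. -/
theorem sectionOfRecord_snd (U : D.carriers.BgB) : (sectionOfRecord D ι U).2 = towerDataOf (D.F.P (D.K + 1)) ι D.avB U.1 := rfl

/-- [folklore] **RUN B's SPECIES OF RECORD AT THE SECTION**: the level-lettered species of run B's torus read through `chi` at the run-B factor of
the section point IS run B's covariance of record at `U` (unitary `ι`). -/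
theorem covAtTLev_chi_sectionOfRecord_snd (hι : ∀ g, ι g ∈ Matrix.unitaryGroup o ℂ) (cL : ℕ → ℂ) (aL : ℕ → ℝ) (s : ℕ → ℂ)
    (Γ : (k : ℕ) → ContourSystem (D.F.P (D.K + 1)).d (lev (D.F.P (D.K + 1)).L k) (unitMod (D.F.P (D.K + 1)))) (U : D.carriers.BgB) (k : ℕ)
    {T : Type*} (t : T) (b b' : (Tor (unitMod (D.F.P (D.K + 1))) × Fin (D.F.P (D.K + 1)).d) × o) :
    covAtTLev (D.F.P (D.K + 1)) cL aL Γ s (chi _ (sectionOfRecord D ι U).2).1 (chi _ (sectionOfRecord D ι U).2).2 k t b b' =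
      SubstrateRawSpecies.covAtOfRecord (D.F.P (D.K + 1)) ι D.avB (cL k) (aL k) s Γ U.1 k t b b' :=
  covAtTLev_chi_towerDataOf _ ι D.avB cL aL s Γ hι U.1 k t b b'

/-- [folklore] **RUN A's SPECIES OF RECORD AT THE SECTION** (through the transporter). -/
theorem covAtTLev_chi_sectionOfRecord_fst (hι : ∀ g, ι g ∈ Matrix.unitaryGroup o ℂ) (cL : ℕ → ℂ) (aL : ℕ → ℝ) (s : ℕ → ℂ)
    (Γ : (k : ℕ) → ContourSystem (D.F.P D.K).d (lev (D.F.P D.K).L k) (unitMod (D.F.P D.K))) (U : D.carriers.BgB) (k : ℕ)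
    {T : Type*} (t : T) (b b' : (Tor (unitMod (D.F.P D.K)) × Fin (D.F.P D.K).d) × o) :
    covAtTLev (D.F.P D.K) cL aL Γ s (chi _ (sectionOfRecord D ι U).1).1 (chi _ (sectionOfRecord D ι U).1).2 k t b b' =
      SubstrateRawSpecies.covAtOfRecord (D.F.P D.K) ι D.avA (cL k) (aL k) s Γ (D.carriers.transport U).1 k t b b' :=
  covAtTLev_chi_towerDataOf _ ι D.avA cL aL s Γ hι (D.carriers.transport U).1 k t b b'

end TwoRun

end Summit.QuantumFields.BalabanUV.T4Continuum.SubstrateChartSection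

end
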